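import Summits.ValiantsHypothesis.ValiantsHypothesis.Theorems.KPlusLogSqLawTropicalGradedWalkPotD

/-!
# Route «KPlusLogSqLaw» — GRW-lite (all-`m` `K = 4` family), part P-M: the row potentials of the states of the LAST PHASE `w = m`

HONEST FRAMING.  Definitions file of the chain `--supports` the crux `Summit.ValiantsHypothesis.ValiantsHypothesis.Theses.KPlusLogSqLaw.TropicalB`
(item `stmt-ValiantsHypothesis-19771`, route `KPlusLogSqLaw`; cell `pub-symmetroid`, seat val-sym-trop-p3 g15, 2026-08-29), on top of
`…TropicalGradedWalkDefs.lean` / `…PotD.lean`.  It proves nothing about `TropicalB` in its window, `WeakLifting`, the doors, `MatrixDescartes`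
or `VP ≠ VNP`: the GRW-lite family is a CENSUS-SIDE (lower-bound) construction for `TropRootLawAt (n+1) 4`.

CONTENT.  The dual certificates (row potentials for `TropicalCensus.isDominant_of_scaledPotential`, SCALE `6`) of the three kinds of states of
phase `m = n + 1` of the design (`…GradedWalkDefs`): the diagonal states `(m, u, 0)` (`u < m`, slope `thM n u 0`), the DEEP EXCURSIONS `(m, u, t)`
(`1 ≤ t ≤ u < m`, slope `thM n u t = L·m + M₂·u + 4t`; rows `u − t, …, u` cycled, connector `(u − t, u)`), and the top states `(m, m, t)`
(slope `thMT n t = L·m + M₂·m + 2t`).  Each potential is `6·g·θ·a` plus a BEND, and the bend is the cumulative sum of TIGHT adjacent-row steps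
along one path (found by the seat numerically — every phase-`m` state admits it, exact check `m ≤ 14`): an UP step at every row (the rival one row
above the intended diagonal cell, class `3` at level `n`, has slack exactly `1`), except that for an excursion of depth `t` the `t` steps between the
rows `u − t + 1, …, u + 1` are DOWN steps (the diagonal class-`2` rival of the sub-diagonal class-`3` column, resp. the class-`1` rival one row
below the diagonal cell of column `u + 1`, is tight) and the step into row `u − t + 1` is taken through the connector column.  Summing the step
polynomials (Faulhaber) gives the closed forms below, stated as SIX TIMES the bend (integer coefficients; hence scale `6`): `bXlo` / `bXmid` /
`bXhi` (rows `a ≤ u − t` / `u − t < a ≤ u` / `a > u` of an excursion), `bDlo` / `bDhi` (rows `a ≤ u` / `a ≥ u` of a diagonal state), `bTlo` / `bThi`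
(rows `a ≤ t` / `a ≥ t` of a top state), the piecewise bends `bX`, `bD`, `bT` and the potentials `UMX`, `UMD`, `UMT`; plus the if-free top-level
switch times `tau2top`, `tau3top` and the regime lemmas.  The slack inequalities are in the companion files `…GradedWalkDomM*.lean` (generator
`tools/gen_m.py` of the seat); located basis: the whole certificate was checked in exact integer arithmetic for every state of phase `m`, `m ≤ 14`.
-/

set_option linter.dupNamespace false
set_option autoImplicit false

namespace Summit.ValiantsHypothesis.ValiantsHypothesis.Theorems.LacunarySymmetroidMatrixDescartes.TropicalCensus

namespace GradedWalk

variable (n : ℕ)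

/-! ### slopes and top-level switch times -/

/-- slope of the phase-`m` state `(m, u, t)`, `u < m`: `L·m + M₂·u + 4t`. -/
def thM (u t : ℕ) : ℤ := LL n * ((n : ℤ) + 1) + M2 n * u + 4 * t
/-- slope of the top state `(m, m, t)`: `L·m + M₂·m + 2t`. -/
def thMT (t : ℕ) : ℤ := LL n * ((n : ℤ) + 1) + M2 n * ((n : ℤ) + 1) + 2 * t
/-- `τ₂` at the top level `E = m` (if-free form of `tau2 n (n+1)`). -/
def tau2top (b : ℕ) : ℤ := LL n * ((n : ℤ) + 1) + M2 n * b + 4 * b + 3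
/-- `τ₃` at the top level `E = m` (if-free form of `tau3 n (n+1)`). -/
def tau3top (b : ℕ) : ℤ := LL n * ((n : ℤ) + 1) + M2 n * ((n : ℤ) + 1) + 2 * b + 1

/-! ### six times the bends (closed forms) -/

/-- six times the bend of the excursion `(m, u, t)` at a row `a ≤ u − t` (up steps through class-`2` diagonal columns). -/
def bXlo (u t a : ℕ) : ℤ :=
  ((-5 : ℤ) * (a : ℤ) + (-7 : ℤ) * (a : ℤ) * (n : ℤ) + (-24 : ℤ) * (a : ℤ) * (n : ℤ) * (t : ℤ) + (-186 : ℤ) * (a : ℤ) * (n : ℤ) * (u : ℤ) + (-12 : ℤ) * (a : ℤ) * (n : ℤ) ^ 2 + (-54 : ℤ) * (a : ℤ) * (n : ℤ) ^ 2 * (u : ℤ) + (-3 : ℤ) * (a : ℤ) * (n : ℤ) ^ 3 + (-6 : ℤ) * (a : ℤ) * (n : ℤ) ^ 3 * (u : ℤ) + (-72 : ℤ) * (a : ℤ) * (t : ℤ) + (-234 : ℤ) * (a : ℤ) * (u : ℤ) + (-63 : ℤ) * (a : ℤ) ^ 2 + (-99 : ℤ) * (a : ℤ) ^ 2 * (n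 : ℤ) + (-12 : ℤ) * (a : ℤ) ^ 2 * (n : ℤ) ^ 2 + (3 : ℤ) * (a : ℤ) ^ 2 * (n : ℤ) ^ 3 + (14 : ℤ) * (a : ℤ) ^ 3 + (4 : ℤ) * (a : ℤ) ^ 3 * (n : ℤ))
/-- six times the bend of the excursion `(m, u, t)` at a row `u − t < a ≤ u` (after the connector step, down steps inside the cycle). -/
def bXmid (u t a : ℕ) : ℤ :=
  ((-17 : ℤ) * (a : ℤ) + (-7 : ℤ) * (a : ℤ) * (n : ℤ) + (-24 : ℤ) * (a : ℤ) * (n : ℤ) * (t : ℤ) + (-186 : ℤ) * (a : ℤ) * (n : ℤ) * (u : ℤ) + (-12 : ℤ) * (a : ℤ) * (n : ℤ) ^ 2 + (-54 : ℤ) * (a : ℤ) * (n : ℤ) ^ 2 * (u : ℤ) + (-3 : ℤ) * (a : ℤ) * (n : ℤ) ^ 3 + (-6 : ℤ) * (a : ℤ) * (n : ℤ) ^ 3 * (u : ℤ) + (-72 : ℤ) * (a : ℤ) * (t : ℤ) + (-234 : ℤ) * (a : ℤ) * (u : ℤ) + (-63 : ℤ) * (a : ℤ) ^ 2 + (-99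 : ℤ) * (a : ℤ) ^ 2 * (n : ℤ) + (-12 : ℤ) * (a : ℤ) ^ 2 * (n : ℤ) ^ 2 + (3 : ℤ) * (a : ℤ) ^ 2 * (n : ℤ) ^ 3 + (14 : ℤ) * (a : ℤ) ^ 3 + (4 : ℤ) * (a : ℤ) ^ 3 * (n : ℤ) + (-12 : ℤ) * (t : ℤ) + (12 : ℤ) * (u : ℤ))
/-- six times the bend of the excursion `(m, u, t)` at a row `a > u` (after the last down step, up steps through class-`1` diagonal columns). -/
def bXhi (u t a : ℕ) : ℤ :=
  ((114 : ℤ) + (61 : ℤ) * (a : ℤ) + (62 : ℤ) * (a : ℤ) * (n : ℤ) + (-36 : ℤ) * (a : ℤ) * (n : ℤ) * (u : ℤ) + (12 : ℤ) * (a : ℤ) * (n : ℤ) ^ 2 + (-6 : ℤ) * (a : ℤ) * (n : ℤ) ^ 2 * (u : ℤ) + (-24 : ℤ) * (a : ℤ) * (t : ℤ) + (-78 : ℤ) * (a : ℤ) * (u : ℤ) + (-165 : ℤ) * (a : ℤ) ^ 2 + (-186 : ℤ) * (a : ℤ) ^ 2 * (n : ℤ) + (-36 : ℤ) * (a : ℤ)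 ^ 2 * (n : ℤ) ^ 2 + (14 : ℤ) * (a : ℤ) ^ 3 + (4 : ℤ) * (a : ℤ) ^ 3 * (n : ℤ) + (54 : ℤ) * (n : ℤ) + (-24 : ℤ) * (n : ℤ) * (t : ℤ) + (-24 : ℤ) * (n : ℤ) * (t : ℤ) * (u : ℤ) + (-45 : ℤ) * (n : ℤ) * (u : ℤ) + (-63 : ℤ) * (n : ℤ) * (u : ℤ) ^ 2 + (6 : ℤ) * (n : ℤ) ^ 2 + (-24 : ℤ) * (n : ℤ) ^ 2 * (u : ℤ) + (-24 : ℤ) * (n : ℤ) ^ 2 * (u : ℤ) ^ 2 + (-3 : ℤ) * (n : ℤ) ^ 3 * (u : ℤ) + (-3 : ℤ) * (n : ℤ) ^ 3 * (u : ℤ) ^ 2 + (-84 : ℤ) * (t : ℤ) + (-48 : ℤ) * (t : ℤ) * (u : ℤ) + (-18 : ℤ) * (u : ℤ) + (-54 : ℤ) * (u : ℤ) ^ 2)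
/-- six times the bend of the diagonal state `(m, u, 0)` at a row `a ≤ u`. -/
def bDlo (u a : ℕ) : ℤ :=
  ((-5 : ℤ) * (a : ℤ) + (-7 : ℤ) * (a : ℤ) * (n : ℤ) + (-186 : ℤ) * (a : ℤ) * (n : ℤ) * (u : ℤ) + (-12 : ℤ) * (a : ℤ) * (n : ℤ) ^ 2 + (-54 : ℤ) * (a : ℤ) * (n : ℤ) ^ 2 * (u : ℤ) + (-3 : ℤ) * (a : ℤ) * (n : ℤ) ^ 3 + (-6 : ℤ) * (a : ℤ) * (n : ℤ) ^ 3 * (u : ℤ) + (-234 : ℤ) * (a : ℤ) * (u : ℤ) + (-63 : ℤ) * (a : ℤ) ^ 2 + (-99 : ℤ) * (a : ℤ) ^ 2 * (n : ℤ) + (-12 : ℤ) * (a : ℤ) ^ 2 * (n : ℤ) ^ 2 + (3 : ℤ) * (a : ℤ) ^ 2 * (n : ℤ) ^ 3 + (14 : ℤ) * (a : ℤ) ^ 3 + (4 : ℤ) * (a : ℤ) ^ 3 * (n : ℤ))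
/-- six times the bend of the diagonal state `(m, u, 0)` at a row `a ≥ u`. -/
def bDhi (u a : ℕ) : ℤ :=
  ((61 : ℤ) * (a : ℤ) + (62 : ℤ) * (a : ℤ) * (n : ℤ) + (-36 : ℤ) * (a : ℤ) * (n : ℤ) * (u : ℤ) + (12 : ℤ) * (a : ℤ) * (n : ℤ) ^ 2 + (-6 : ℤ) * (a : ℤ) * (n : ℤ) ^ 2 * (u : ℤ) + (-78 : ℤ) * (a : ℤ) * (u : ℤ) + (-165 : ℤ) * (a : ℤ) ^ 2 + (-186 : ℤ) * (a : ℤ) ^ 2 * (n : ℤ) + (-36 : ℤ) * (a : ℤ) ^ 2 * (n : ℤ) ^ 2 + (14 : ℤ) * (a : ℤ) ^ 3 + (4 : ℤ) * (a : ℤ) ^ 3 * (n : ℤ) + (-69 : ℤ) * (n : ℤ) * (u : ℤ) + (-63 : ℤ) * (n : ℤ) * (u : ℤ) ^ 2 + (-24 : ℤ) * (n : ℤ) ^ 2 * (u : ℤ) + (-24 : ℤ) * (n : ℤ) ^ 2 * (u : ℤ) ^ 2 + (-3 : ℤ) * (n : ℤ) ^ 3 * (u : ℤ) + (-3 : ℤ)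 * (n : ℤ) ^ 3 * (u : ℤ) ^ 2 + (-66 : ℤ) * (u : ℤ) + (-54 : ℤ) * (u : ℤ) ^ 2)
/-- six times the bend of the top state `(m, m, t)` at a row `a ≤ t`. -/
def bTlo (t a : ℕ) : ℤ :=
  ((-239 : ℤ) * (a : ℤ) + (-427 : ℤ) * (a : ℤ) * (n : ℤ) + (-12 : ℤ) * (a : ℤ) * (n : ℤ) * (t : ℤ) + (-252 : ℤ) * (a : ℤ) * (n : ℤ) ^ 2 + (-63 : ℤ) * (a : ℤ) * (n : ℤ) ^ 3 + (-6 : ℤ) * (a : ℤ) * (n : ℤ) ^ 4 + (-48 : ℤ) * (a : ℤ) * (t : ℤ) + (-57 : ℤ) * (a : ℤ) ^ 2 + (-99 : ℤ) * (a : ℤ) ^ 2 * (n : ℤ) + (-12 : ℤ) * (a : ℤ) ^ 2 * (n : ℤ) ^ 2 + (3 : ℤ) * (a : ℤ) ^ 2 * (n : ℤ) ^ 3 + (14 : ℤ) * (a : ℤ) ^ 3 + (4 : ℤ) * (a : ℤ) ^ 3 * (n : ℤ))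
/-- six times the bend of the top state `(m, m, t)` at a row `a ≥ t`. -/
def bThi (t a : ℕ) : ℤ :=
  ((-239 : ℤ) * (a : ℤ) + (-427 : ℤ) * (a : ℤ) * (n : ℤ) + (-12 : ℤ) * (a : ℤ) * (n : ℤ) * (t : ℤ) + (-252 : ℤ) * (a : ℤ) * (n : ℤ) ^ 2 + (-63 : ℤ) * (a : ℤ) * (n : ℤ) ^ 3 + (-6 : ℤ) * (a : ℤ) * (n : ℤ) ^ 4 + (-36 : ℤ) * (a : ℤ) * (t : ℤ) + (-63 : ℤ) * (a : ℤ) ^ 2 + (-99 : ℤ) * (a : ℤ) ^ 2 * (n : ℤ) + (-12 : ℤ) * (a : ℤ) ^ 2 * (n : ℤ) ^ 2 + (3 : ℤ) * (a : ℤ) ^ 2 * (n : ℤ) ^ 3 + (14 : ℤ) * (a : ℤ) ^ 3 + (4 : ℤ) * (a : ℤ) ^ 3 * (n : ℤ) + (-6 : ℤ) * (t : ℤ) ^ 2)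

/-! ### piecewise bends and the potentials (scale `6`) -/

/-- six times the bend of the excursion `(m, u, t)` at row `a`. -/
def bX (u t a : ℕ) : ℤ := if a + t ≤ u then bXlo n u t a else if a ≤ u then bXmid n u t a else bXhi n u t a
/-- six times the bend of the diagonal state `(m, u, 0)` at row `a`. -/
def bD (u a : ℕ) : ℤ := if a ≤ u then bDlo n u a else bDhi n u a
/-- six times the bend of the top state `(m, m, t)` at row `a`. -/
def bT (t a : ℕ) : ℤ := if a ≤ t then bTlo n t a else bThi n t a
/-- row potential (scale `6`) of the excursion `(m, u, t)`, `1 ≤ t ≤ u < m`. -/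
def UMX (u t a : ℕ) : ℤ := 6 * (gG n * thM n u t * a) + bX n u t a
/-- row potential (scale `6`) of the diagonal state `(m, u, 0)`, `u < m`. -/
def UMD (u a : ℕ) : ℤ := 6 * (gG n * thM n u 0 * a) + bD n u a
/-- row potential (scale `6`) of the top state `(m, m, t)`, `t ≤ m`. -/
def UMT (t a : ℕ) : ℤ := 6 * (gG n * thMT n t * a) + bT n t a

/-! ### interface lemmas -/

/-- at the top level `τ₂` is `tau2top`. -/
theorem tau2_top (b : ℕ) : tau2 n (n + 1) b = tau2top n b := by
  unfold tau2 tau2top; rw [if_pos rfl]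

/-- at the top level `τ₃` is `tau3top`. -/
theorem tau3_top (b : ℕ) : tau3 n (n + 1) b = tau3top n b := by
  unfold tau3 tau3top; rw [if_pos rfl]

/-- the slope of the phase-`m` state `(m, u, t)`, `u < m`, is `thM`. -/
theorem theta_MX {u : ℕ} (hu : u < n + 1) (t : ℕ) : theta n (n + 1) u t = thM n u t := by
  unfold theta thM Mw
  rw [if_pos rfl, if_pos hu]
  push_cast; ring

/-- the slope of the top state `(m, m, t)` is `thMT`. -/
theorem theta_MT (t : ℕ) : theta n (n + 1) (n + 1) t = thMT n t := by
  unfold theta thMT Mw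
  rw [if_pos rfl, if_neg (lt_irrefl _)]
  push_cast; ring

/-- bend regime `a ≤ u − t`. -/
theorem bX_lo {u t a : ℕ} (h : a + t ≤ u) : bX n u t a = bXlo n u t a := by
  unfold bX; rw [if_pos h]

/-- bend regime `u − t < a ≤ u`. -/
theorem bX_mid {u t a : ℕ} (h1 : ¬ a + t ≤ u) (h2 : a ≤ u) : bX n u t a = bXmid n u t a := by
  unfold bX; rw [if_neg h1, if_pos h2]

/-- bend regime `a > u`. -/
theorem bX_hi {u t a : ℕ} (h : ¬ a ≤ u) : bX n u t a = bXhi n u t a := by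
  unfold bX; rw [if_neg (by omega), if_neg h]

/-- bend regime `a ≤ u` of a diagonal state. -/
theorem bD_lo {u a : ℕ} (h : a ≤ u) : bD n u a = bDlo n u a := by
  unfold bD; rw [if_pos h]

/-- bend regime `a > u` of a diagonal state. -/
theorem bD_hi {u a : ℕ} (h : ¬ a ≤ u) : bD n u a = bDhi n u a := by
  unfold bD; rw [if_neg h]

/-- bend regime `a ≤ t` of a top state. -/
theorem bT_lo {t a : ℕ} (h : a ≤ t) : bT n t a = bTlo n t a := by
  unfold bT; rw [if_pos h]

/-- bend regime `a > t` of a top state. -/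
theorem bT_hi {t a : ℕ} (h : ¬ a ≤ t) : bT n t a = bThi n t a := by
  unfold bT; rw [if_neg h]

end GradedWalk

end Summit.ValiantsHypothesis.ValiantsHypothesis.Theorems.LacunarySymmetroidMatrixDescartes.TropicalCensus
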